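import Summits.Ventures.DiscreteObjects.Hadamard.SimilarSublatticeGlue

/-!
# From a 167-similar sublattice of A₂₈ to a fixed-point-free Z₂₃ orbit matrix of H(668) (kernel; Proposition 2.1, converse)

Framing: lottery ticket; floor = certified bounds/negative ranges.

Cell pub-namedobj (venture DiscreteObjects), target (H), hadamard gen 9 (FAMILY-F12-G9 §2).  Given `u_1, …, u_28 ∈ ℤ²⁹` with
coordinate sums `0` and Gram matrix `167·(I + J)`:
* `sum_residue_pm14`: the common residue `c` of the coordinates of `S = Σ u_i` (`SimilarSublatticeGlue.sum_congr_mod29`)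
  satisfies `c² ≡ 22 ≡ 14² (mod 29)`, i.e. `S ≡ 14·𝟙` or `S ≡ −14·𝟙 (mod 29)` (from `Σ_k S_k = 0`, `Σ_k S_k² = 28·167·29`);
* `lattice_matrix_of_multiplier`: if `S ≡ 14·𝟙`, the integer matrix `B` with last row `t = (14·𝟙 − S)/29` and rows `t + u_i`
  has `B Bᵀ = 167·I + J` and all row and column sums `14`;
* `exists_orbitMatrix_of_similar_sublattice` (**Proposition 2.1, converse direction**): replacing `u` by `−u` if necessary and
  putting `A = 2B − J`: **there is a `29 × 29` matrix `A` with odd entries, `A Aᵀ = 668·I − 23·J` and all row and column sums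
  `−1`** — the Hadamard-form orbit matrix of a fixed-point-free automorphism of order 23 of a putative H(668) (`|a| ≤ 23` is
  then automatic: `|a|² ≤ 645 − 27`; the column Gram `Aᵀ A = 668·I − 23·J` follows since `Θ = [[A, √23𝟙],[√23𝟙ᵀ,1]]` is
  square with `Θ Θᵀ = 668 I`).  The direct direction (orbit matrix ⇒ multiplier: `u_i = (row_i − row_29)(B)`, `B = (A+J)/2`) is
  immediate and is witnessed explicitly in `OrbitMatrixWitnesses668` / `Z23OrbitMatrixCertificate`.  So: **fixed-point-free Z₂₃
  orbit matrices of H(668) exist iff the root lattice A₂₈ has a similar sublattice of norm 167.**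
Ours, not literature; no `sorry`.
-/
open Finset BigOperators Matrix

namespace Summit.Ventures.DiscreteObjects.Hadamard.SimilarSublattice

/-- squares equal to `22` in `ZMod 29` are `(±14)²` -/
private lemma sq_eq_22_mod29 (x : ZMod 29) (hx : x * x = 22) : x = 14 ∨ x = -14 := by
  revert x; decide

/-- **Glue lemma, step 2.** The common residue `c` of the coordinates of `S = Σ u_i` satisfies `c ≡ ±14 (mod 29)`. -/
theorem sum_residue_pm14 (u : Fin 28 → Fin 29 → ℤ) (hsum : ∀ i, ∑ k, u i k = 0)
    (hgram : ∀ i j, ∑ k, u i k * u j k = if i = j then 334 else 167) :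
    (∀ k, (29 : ℤ) ∣ 14 - ∑ i, u i k) ∨ (∀ k, (29 : ℤ) ∣ 14 + ∑ i, u i k) := by
  obtain ⟨S, hS⟩ : ∃ S : Fin 29 → ℤ, ∀ k, S k = ∑ i, u i k := ⟨_, fun k => rfl⟩
  have hcong : ∀ k, (29 : ℤ) ∣ S k - S 0 := fun k => by rw [hS, hS]; exact sum_congr_mod29 u hsum hgram k 0
  choose m hm using hcong   -- S k - S 0 = 29 * m k
  have hSk : ∀ k, S k = S 0 + 29 * m k := fun k => by linarith [hm k]
  -- Σ_k S k = 0
  have hS1 : ∑ k, S k = 0 := by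
    simp_rw [hS]
    rw [Finset.sum_comm]
    simp [hsum]
  -- Σ_k S k² = 135604
  have hS2 : ∑ k, S k * S k = 135604 := by
    simp_rw [hS]
    simp_rw [Finset.sum_mul_sum]
    rw [Finset.sum_comm]
    have inner : ∀ i, ∑ k, ∑ j, u i k * u j k = ∑ j, ∑ k, u i k * u j k := fun i => Finset.sum_comm
    simp_rw [inner, hgram]
    decide
  -- substitute S k = c + 29 m k
  set c := S 0 with hc
  have e1 : (29 : ℤ) * c + 29 * ∑ k, m k = 0 := by
    have : ∑ k, S k = ∑ k, (c + 29 * m k) := Finset.sum_congr rfl (fun k _ => hSk k)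
    rw [hS1, Finset.sum_add_distrib, Finset.sum_const, Finset.card_univ, Fintype.card_fin, ← Finset.mul_sum] at this
    simp only [nsmul_eq_mul] at this
    push_cast at this
    linarith
  have e2 : ∑ k, (c + 29 * m k) * (c + 29 * m k) = 135604 := by
    rw [← hS2]; exact (Finset.sum_congr rfl (fun k _ => by rw [hSk k])).symm
  have e3 : ∑ k, (c + 29 * m k) * (c + 29 * m k) = 29 * (c * c) + 58 * c * ∑ k, m k + 841 * ∑ k, m k * m k := by
    have : ∀ k, (c + 29 * m k) * (c + 29 * m k) = c * c + 58 * c * m k + 841 * (m k * m k) := fun k => by ring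
    simp_rw [this]
    rw [Finset.sum_add_distrib, Finset.sum_add_distrib, Finset.sum_const, Finset.card_univ, Fintype.card_fin,
      ← Finset.mul_sum, ← Finset.mul_sum]
    simp only [nsmul_eq_mul]
    push_cast
    ring
  have hM : ∑ k, m k = -c := by linarith
  rw [e3, hM] at e2
  -- e2 : 29 c² − 58 c² + 841 Σ m² = 135604 ⇒ c² ≡ 22 (mod 29)
  have hc2 : (29 : ℤ) ∣ c * c - 22 := by
    have : 841 * ∑ k, m k * m k - 29 * (c * c) = 135604 := by linarith
    exact ⟨∑ k, m k * m k - 162, by linarith⟩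
  have hcz : ((c : ZMod 29)) * (c : ZMod 29) = 22 := by
    have h := (ZMod.intCast_zmod_eq_zero_iff_dvd (c * c - 22) 29).mpr hc2
    push_cast at h
    linear_combination h
  rcases sq_eq_22_mod29 _ hcz with h14 | h14
  · left
    intro k
    rw [← hS k, hSk k]
    have : ((14 - c : ℤ) : ZMod 29) = 0 := by push_cast; rw [h14]; ring
    have hd := (ZMod.intCast_zmod_eq_zero_iff_dvd _ 29).mp this
    obtain ⟨q, hq⟩ := hd
    push_cast at hq
    exact ⟨q - m k, by linarith⟩
  · right
    intro k
    rw [← hS k, hSk k]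
    have : ((14 + c : ℤ) : ZMod 29) = 0 := by push_cast; rw [h14]; ring
    have hd := (ZMod.intCast_zmod_eq_zero_iff_dvd _ 29).mp this
    obtain ⟨q, hq⟩ := hd
    push_cast at hq
    exact ⟨q + m k, by linarith⟩

/-- **Glue lemma, step 3 (construction).**  If `29 ∣ 14 − S_k` for all `k`, the matrix `B` with last row `t = (14·𝟙 − S)/29`
and rows `t + u_i` satisfies `B Bᵀ = 167 I + J`, all row sums and column sums `14`. -/
theorem lattice_matrix_of_multiplier (u : Fin 28 → Fin 29 → ℤ) (hsum : ∀ i, ∑ k, u i k = 0)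
    (hgram : ∀ i j, ∑ k, u i k * u j k = if i = j then 334 else 167)
    (h14 : ∀ k, (29 : ℤ) ∣ 14 - ∑ i, u i k) :
    ∃ B : Matrix (Fin 29) (Fin 29) ℤ,
      (∀ i j, ∑ k, B i k * B j k = if i = j then 168 else 1) ∧ (∀ i, ∑ k, B i k = 14) ∧ (∀ k, ∑ i, B i k = 14) := by
  obtain ⟨S, hS⟩ : ∃ S : Fin 29 → ℤ, ∀ k, S k = ∑ i, u i k := ⟨_, fun k => rfl⟩
  choose t ht using h14   -- 14 - S k = 29 * t k
  have htk : ∀ k, S k = 14 - 29 * t k := fun k => by have := ht k; rw [hS]; linarith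
  -- facts about S
  have hSu : ∀ j, ∑ k, S k * u j k = 4843 := by
    intro j
    simp_rw [hS, Finset.sum_mul]
    rw [Finset.sum_comm]
    have : ∀ i, ∑ k, u i k * u j k = if i = j then 334 else 167 := fun i => hgram i j
    simp_rw [this]
    have : ∀ x : Fin 28, (if x = j then (334 : ℤ) else 167) = 167 + (if x = j then 167 else 0) := by
      intro x; split_ifs <;> norm_num
    simp_rw [this]
    rw [Finset.sum_add_distrib, Finset.sum_ite_eq' Finset.univ j, if_pos (Finset.mem_univ j), Finset.sum_const,
      Finset.card_univ, Fintype.card_fin]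
    norm_num
  have hS1 : ∑ k, S k = 0 := by
    simp_rw [hS]
    rw [Finset.sum_comm]
    simp [hsum]
  have hS2 : ∑ k, S k * S k = 135604 := by
    simp_rw [hS]
    simp_rw [Finset.sum_mul_sum]
    rw [Finset.sum_comm]
    have inner : ∀ i, ∑ k, ∑ j, u i k * u j k = ∑ j, ∑ k, u i k * u j k := fun i => Finset.sum_comm
    simp_rw [inner, hgram]
    decide
  -- facts about t (all multiplied by 29 or 841 to stay in ℤ)
  have ht1 : ∑ k, t k = 14 := by
    have : ∑ k, S k = ∑ k, (14 - 29 * t k) := Finset.sum_congr rfl (fun k _ => htk k)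
    rw [hS1, Finset.sum_sub_distrib, Finset.sum_const, Finset.card_univ, Fintype.card_fin, ← Finset.mul_sum] at this
    simp only [nsmul_eq_mul] at this
    push_cast at this
    linarith
  have htu : ∀ j, ∑ k, t k * u j k = -167 := by
    intro j
    have h29 : ∑ k, (29 * t k) * u j k = -4843 := by
      have : ∀ k, (29 * t k) * u j k = 14 * u j k - S k * u j k := fun k => by rw [htk k]; ring
      simp_rw [this]
      rw [Finset.sum_sub_distrib, ← Finset.mul_sum, hsum j, hSu j]
      ring
    have : ∑ k, (29 * t k) * u j k = 29 * ∑ k, t k * u j k := by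
      rw [Finset.mul_sum]; exact Finset.sum_congr rfl (fun k _ => by ring)
    rw [this] at h29
    linarith
  have htt : ∑ k, t k * t k = 168 := by
    have h841 : ∑ k, (29 * t k) * (29 * t k) = 841 * 168 := by
      have : ∀ k, (29 * t k) * (29 * t k) = 196 - 28 * S k + S k * S k := fun k => by rw [htk k]; ring
      simp_rw [this]
      rw [Finset.sum_add_distrib, Finset.sum_sub_distrib, Finset.sum_const, Finset.card_univ, Fintype.card_fin,
        ← Finset.mul_sum, hS1, hS2]
      simp
    have : ∑ k, (29 * t k) * (29 * t k) = 841 * ∑ k, t k * t k := by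
      rw [Finset.mul_sum]; exact Finset.sum_congr rfl (fun k _ => by ring)
    rw [this] at h841
    linarith
  -- the matrix
  let B : Matrix (Fin 29) (Fin 29) ℤ := fun i k => Fin.lastCases (t k) (fun i' => t k + u i' k) i
  have hBlast : ∀ k, B (Fin.last 28) k = t k := fun k => by
    simp only [B]; exact Fin.lastCases_last
  have hBcast : ∀ i' k, B (Fin.castSucc i') k = t k + u i' k := fun i' k => by
    simp only [B]; exact Fin.lastCases_castSucc _
  refine ⟨B, ?_, ?_, ?_⟩
  · -- Gram
    intro i j
    refine Fin.lastCases ?_ (fun i' => ?_) i <;> refine Fin.lastCases ?_ (fun j' => ?_) j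
    · rw [if_pos rfl]
      simp_rw [hBlast]
      exact htt
    · rw [if_neg (Fin.castSucc_lt_last j').ne']
      simp_rw [hBlast, hBcast]
      have : ∀ k, t k * (t k + u j' k) = t k * t k + t k * u j' k := fun k => by ring
      simp_rw [this]
      rw [Finset.sum_add_distrib, htt, htu]
      norm_num
    · rw [if_neg (Fin.castSucc_lt_last i').ne]
      simp_rw [hBlast, hBcast]
      have : ∀ k, (t k + u i' k) * t k = t k * t k + t k * u i' k := fun k => by ring
      simp_rw [this]
      rw [Finset.sum_add_distrib, htt, htu]
      norm_num
    · by_cases hij : i' = j'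
      · subst hij
        rw [if_pos rfl]
        simp_rw [hBcast]
        have : ∀ k, (t k + u i' k) * (t k + u i' k) = t k * t k + t k * u i' k + t k * u i' k + u i' k * u i' k :=
          fun k => by ring
        simp_rw [this]
        rw [Finset.sum_add_distrib, Finset.sum_add_distrib, Finset.sum_add_distrib, htt, htu, hgram, if_pos rfl]
        norm_num
      · rw [if_neg (fun h => hij (Fin.castSucc_injective _ h))]
        simp_rw [hBcast]
        have : ∀ k, (t k + u i' k) * (t k + u j' k) = t k * t k + t k * u j' k + t k * u i' k + u i' k * u j' k :=
          fun k => by ring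
        simp_rw [this]
        rw [Finset.sum_add_distrib, Finset.sum_add_distrib, Finset.sum_add_distrib, htt, htu, htu, hgram, if_neg hij]
        norm_num
  · -- row sums
    intro i
    refine Fin.lastCases ?_ (fun i' => ?_) i
    · simp_rw [hBlast]; exact ht1
    · simp_rw [hBcast]
      rw [Finset.sum_add_distrib, ht1, hsum]
      norm_num
  · -- column sums: t k + Σ_i (t k + u i k) = 29 t k + S k = 14
    intro k
    rw [Fin.sum_univ_castSucc]
    simp_rw [hBcast, hBlast]
    rw [Finset.sum_add_distrib, Finset.sum_const, Finset.card_univ, Fintype.card_fin]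
    simp only [nsmul_eq_mul]
    have := htk k
    rw [hS] at this
    push_cast
    linarith

/-- **Proposition 2.1 (converse): a 167-similar copy of A₂₈ inside A₂₈ yields a fixed-point-free Z₂₃ orbit matrix of H(668).** -/
theorem exists_orbitMatrix_of_similar_sublattice (u : Fin 28 → Fin 29 → ℤ) (hsum : ∀ i, ∑ k, u i k = 0)
    (hgram : ∀ i j, ∑ k, u i k * u j k = if i = j then 334 else 167) :
    ∃ A : Matrix (Fin 29) (Fin 29) ℤ, (∀ i j, Odd (A i j)) ∧
      (∀ i j, ∑ k, A i k * A j k = if i = j then 645 else -23) ∧ (∀ i, ∑ k, A i k = -1) ∧ (∀ k, ∑ i, A i k = -1) := by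
  -- obtain B in lattice form, flipping the sign of u if necessary
  have hB : ∃ B : Matrix (Fin 29) (Fin 29) ℤ,
      (∀ i j, ∑ k, B i k * B j k = if i = j then 168 else 1) ∧ (∀ i, ∑ k, B i k = 14) ∧ (∀ k, ∑ i, B i k = 14) := by
    rcases sum_residue_pm14 u hsum hgram with h | h
    · exact lattice_matrix_of_multiplier u hsum hgram h
    · refine lattice_matrix_of_multiplier (fun i k => -u i k) (fun i => ?_) (fun i j => ?_) (fun k => ?_)
      · rw [Finset.sum_neg_distrib, hsum i, neg_zero]
      · simp_rw [neg_mul_neg]; exact hgram i j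
      · rw [Finset.sum_neg_distrib, sub_neg_eq_add]; exact h k
  obtain ⟨B, hG, hr, hc⟩ := hB
  refine ⟨fun i k => 2 * B i k - 1, fun i j => ⟨B i j - 1, by ring⟩, fun i j => ?_, fun i => ?_, fun k => ?_⟩
  · have : ∀ k, (2 * B i k - 1) * (2 * B j k - 1) = 4 * (B i k * B j k) - 2 * B i k - 2 * B j k + 1 := fun k => by ring
    simp_rw [this]
    rw [Finset.sum_add_distrib, Finset.sum_sub_distrib, Finset.sum_sub_distrib, ← Finset.mul_sum, ← Finset.mul_sum,
      ← Finset.mul_sum, hG, hr, hr, Finset.sum_const, Finset.card_univ, Fintype.card_fin]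
    split_ifs <;> norm_num
  · rw [Finset.sum_sub_distrib, ← Finset.mul_sum, hr, Finset.sum_const, Finset.card_univ, Fintype.card_fin]; norm_num
  · rw [Finset.sum_sub_distrib, ← Finset.mul_sum, hc, Finset.sum_const, Finset.card_univ, Fintype.card_fin]; norm_num

end Summit.Ventures.DiscreteObjects.Hadamard.SimilarSublattice
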